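import Summits.Parity.BatemanHorn.Theorems.SoloInformedTrapezoidBlock
import Summits.Parity.BatemanHorn.Theorems.SoloInformedLocWeightSupport

/-!
# The trapezoid method: a uniform bound for the dyadic blocks

Ledger: this work (soloist programme `solo-Parity-informed`, the `d ≥ 3` rung below the parity wall).

`SoloInformedTrapezoidBlock` bounds one dyadic block `Z(E, E'] = ∑_{E<e≤E'} e⁻¹ ∑_{0<h<e} K_e(h) S_g(h; e)`
of the trapezoid form in terms of two free parameters: the frequency cut `H` and the common vanishing range `A`
of the localisation weights `a_e`, `e ≥ E`.  Here we CHOOSE them,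
* `H(E) = ⌊E^θ⌋/4` (so `2H + 1 ≤ E`, `H ≤ E^θ ≤ 4(H + 1)`; `trapFreq_choice`),
* `A(E) = ⌊(cE²)^{1/d}⌋ − 1` (so `(A+1)^d ≤ cE²`, whence `a_e(m) = 0` for `m ≤ A + 1`, `e ≥ E`, and
  `A ≥ (cE²)^{1/d}/2`; `trapRange_choice`),
discharge the analytic side conditions from the irreducibility of `g` (no integer roots, eventual monotonicity
of `|g(m)|`, the difference bounds for `log|g(m)|`, the support of `a_e`, the boundedness of
`∑_{E<e≤2E} ρ_g(e)/e`), and simplify the block bound to four monomials in `E` (`exists_trapBlock_uniform`):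
`‖Z(E,E']‖ ≤ K·[(2 + log E)(X₁E^{1−η} + X₁·D·E^{1−η−2/d}) + E^{2−θ} + D·E^{2−θ−2/d}]`
for `X₁ = X₀ + D ≤ E ≤ E' ≤ 2E`, `D ≤ X₀`, `X₁ ≥ x₁(g, Δ)`, with `K = K(g, Δ, C)`.
-/

namespace Summit.Parity.BatemanHorn.Theorems

open Finset Polynomial
open Literature.NumberTheory.Sieve (polyRootCountMod)

/-! ### Parameter choices -/

/-- The vanishing range: for `y ≥ max(4, m₀+2)` and `A = ⌊y⌋ − 1`: `m₀ ≤ A`, `1 ≤ A`, `(A+1)^d ≤ y^d`,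
`y/2 ≤ A`. [this work] -/
theorem trapRange_choice {y : ℝ} (hy4 : 4 ≤ y) {m₀ : ℕ} (hym : (m₀ : ℝ) + 2 ≤ y) (d : ℕ) :
    m₀ ≤ ⌊y⌋₊ - 1 ∧ 1 ≤ ⌊y⌋₊ - 1 ∧ ((((⌊y⌋₊ - 1 : ℕ) : ℝ) + 1) ^ d ≤ y ^ d)
      ∧ y / 2 ≤ ((⌊y⌋₊ - 1 : ℕ) : ℝ) := by
  have hy0 : 0 ≤ y := by linarith
  have h4 : 4 ≤ ⌊y⌋₊ := Nat.le_floor (by exact_mod_cast hy4)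
  have hm : m₀ + 2 ≤ ⌊y⌋₊ := Nat.le_floor (by push_cast; exact hym)
  have hcast : (((⌊y⌋₊ - 1 : ℕ) : ℝ) + 1) = (⌊y⌋₊ : ℝ) := by
    rw [Nat.cast_sub (by omega)]; push_cast; ring
  refine ⟨by omega, by omega, ?_, ?_⟩
  · rw [hcast]
    exact pow_le_pow_left₀ (Nat.cast_nonneg _) (Nat.floor_le hy0) d
  · have hlt := Nat.lt_floor_add_one y
    rw [Nat.cast_sub (by omega)]
    push_cast
    linarith

/-- The frequency cut `H = ⌊E^θ⌋/4` (`θ ≤ 1`, `E ≥ 2`): `2H + 1 ≤ E`, `H ≤ E^θ ≤ 4(H+1)`, `H ≤ E`.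
[this work] -/
theorem trapFreq_choice {E : ℕ} (hE : 2 ≤ E) {θ : ℝ} (hθ1 : θ ≤ 1) :
    2 * (⌊(E : ℝ) ^ θ⌋₊ / 4) + 1 ≤ E ∧ (((⌊(E : ℝ) ^ θ⌋₊ / 4 : ℕ) : ℝ) ≤ (E : ℝ) ^ θ)
      ∧ ((E : ℝ) ^ θ ≤ 4 * ((((⌊(E : ℝ) ^ θ⌋₊ / 4 : ℕ) : ℝ)) + 1)) ∧ ⌊(E : ℝ) ^ θ⌋₊ / 4 ≤ E := by
  set n : ℕ := ⌊(E : ℝ) ^ θ⌋₊ with hn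
  have h0 : 0 ≤ (E : ℝ) ^ θ := by positivity
  have hE1 : (1 : ℝ) ≤ E := by exact_mod_cast (show 1 ≤ E by omega)
  have hEθ : (E : ℝ) ^ θ ≤ E := by
    have := Real.rpow_le_rpow_of_exponent_le hE1 hθ1
    rwa [Real.rpow_one] at this
  have hnE : n ≤ E := by exact_mod_cast (Nat.floor_le h0).trans hEθ
  refine ⟨by omega, ?_, ?_, by omega⟩
  · exact le_trans (by exact_mod_cast Nat.div_le_self n 4) (Nat.floor_le h0)
  · have h1 := Nat.lt_floor_add_one ((E : ℝ) ^ θ)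
    have h2 : n + 1 ≤ 4 * (n / 4 + 1) := by omega
    have h3 : ((n : ℝ) + 1) ≤ 4 * (((n / 4 : ℕ) : ℝ) + 1) := by exact_mod_cast h2
    rw [← hn] at h1
    linarith

/-- `∑_{E<e≤E'} ρ_g(e)/e ≤ R₀(g)` uniformly over `1 ≤ E ≤ E' ≤ 2E` (from `P_g(x) = A_g log x + O(1)`).
[this work] -/
theorem exists_sum_Ioc_rootCount_div_le {g : ℤ[X]} (hirr : Irreducible g) (hdeg : 0 < g.natDegree) :
    ∃ R₀ : ℝ, 0 ≤ R₀ ∧ ∀ E E' : ℕ, 1 ≤ E → E ≤ E' → E' ≤ 2 * E →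
      ∑ e ∈ Ioc E E', (polyRootCountMod ![g] e : ℝ) / e ≤ R₀ := by
  obtain ⟨K, hK⟩ := exists_abs_polySmallLevel_sub_log_le hirr hdeg
  have hK0 : 0 ≤ K := by have := hK 1 le_rfl; exact (abs_nonneg _).trans this
  refine ⟨|rootLevelConst g| * Real.log 2 + 2 * K, by positivity, fun E E' hE hEE' hE'2 => ?_⟩
  have hsplit : polySmallLevel g E' = polySmallLevel g E + ∑ e ∈ Ioc E E', (polyRootCountMod ![g] e : ℝ) / e := by
    unfold polySmallLevel
    exact sum_Icc_one_eq_sum_Icc_add_sum_Ioc _ hEE'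
  have h1 := hK E hE
  have h2 := hK E' (by omega)
  rw [abs_le] at h1 h2
  have hE0 : (0 : ℝ) < E := by exact_mod_cast (show 0 < E by omega)
  have hE'0 : (0 : ℝ) < E' := by exact_mod_cast (show 0 < E' by omega)
  have hlog : Real.log E' - Real.log E ≤ Real.log 2 := by
    rw [← Real.log_div hE'0.ne' hE0.ne']
    apply Real.log_le_log (div_pos hE'0 hE0)
    rw [div_le_iff₀ hE0]
    exact_mod_cast hE'2
  have hlog0 : 0 ≤ Real.log E' - Real.log E :=
    sub_nonneg.2 (Real.log_le_log hE0 (by exact_mod_cast hEE'))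
  have hA : rootLevelConst g * (Real.log E' - Real.log E) ≤ |rootLevelConst g| * Real.log 2 := by
    calc rootLevelConst g * (Real.log E' - Real.log E)
        ≤ |rootLevelConst g| * (Real.log E' - Real.log E) :=
          mul_le_mul_of_nonneg_right (le_abs_self _) hlog0
      _ ≤ |rootLevelConst g| * Real.log 2 := mul_le_mul_of_nonneg_left hlog (abs_nonneg _)
  linarith

/-- `log H ≤ log E` for naturals `H ≤ E` (also when `H = 0`). [folklore] -/
theorem log_natCast_le_of_le {H E : ℕ} (h : H ≤ E) : Real.log (H : ℝ) ≤ Real.log (E : ℝ) := by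
  rcases Nat.eq_zero_or_pos H with rfl | hH
  · simp only [Nat.cast_zero, Real.log_zero]; exact Real.log_natCast_nonneg E
  · exact Real.log_le_log (by exact_mod_cast hH) (by exact_mod_cast h)

/-! ### The real algebra of the simplification -/

/-- Collecting the simplified block bound into four monomials. [this work] -/
theorem uniform_algebra {C Δ D X₁ N ℓ M₁ M₂ M₃ M₄ V₀ K₂ R₀ c₀ y : ℝ} (hC : 0 ≤ C) (hΔ : 0 < Δ)
    (hD : 0 ≤ D) (hDX : D ≤ X₁) (hN : N ≤ 3 * X₁) (hℓ : 2 ≤ ℓ) (hM₁ : 0 ≤ M₁) (hM₂ : 0 ≤ M₂)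
    (hM₃ : 0 ≤ M₃) (hM₄ : 0 ≤ M₄) (hV₀ : 0 ≤ V₀) (hK₂ : 0 ≤ K₂) (hR₀ : 0 ≤ R₀) (hc₀ : 0 < c₀)
    (hy1 : M₁ / y = M₂ / c₀) (hy3 : M₃ / y = M₄ / c₀) :
    2 * ((D / 2 + (D / (2 * Δ) + Real.pi / 8 * (N * (V₀ + D * K₂ / y) + 4 * D) + D / 2)) * (C * M₁ * ℓ)
          + Real.pi ^ 2 * D * C * M₁) + (V₀ + D * K₂ / y) * (4 * R₀ * M₃)
      ≤ (2 * C * (1 + 1 / (2 * Δ) + Real.pi / 2) + 3 * Real.pi / 4 * C * V₀ + Real.pi ^ 2 * C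
          + 3 * Real.pi / (4 * c₀) * C * K₂ + 4 * R₀ * V₀ + 4 * R₀ * K₂ / c₀)
        * (ℓ * (X₁ * M₁ + X₁ * D * M₂) + M₃ + D * M₄) := by
  have hpi := Real.pi_pos.le
  have eq1 : 2 * ((D / 2 + (D / (2 * Δ) + Real.pi / 8 * (N * (V₀ + D * K₂ / y) + 4 * D) + D / 2))
        * (C * M₁ * ℓ) + Real.pi ^ 2 * D * C * M₁) + (V₀ + D * K₂ / y) * (4 * R₀ * M₃)
      = 2 * C * M₁ * ℓ * (D * (1 + 1 / (2 * Δ) + Real.pi / 2) + Real.pi / 8 * N * V₀)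
        + 2 * Real.pi ^ 2 * D * C * M₁ + Real.pi / 4 * C * ℓ * N * D * K₂ * (M₁ / y)
        + 4 * R₀ * V₀ * M₃ + 4 * R₀ * D * K₂ * (M₃ / y) := by ring
  rw [eq1, hy1, hy3]
  have hX : 0 ≤ X₁ := hD.trans hDX
  have hℓ0 : 0 ≤ ℓ := by linarith
  have t1 : 2 * C * M₁ * ℓ * (D * (1 + 1 / (2 * Δ) + Real.pi / 2))
      ≤ 2 * C * (1 + 1 / (2 * Δ) + Real.pi / 2) * (ℓ * (X₁ * M₁)) := by
    have h : 0 ≤ 2 * C * (1 + 1 / (2 * Δ) + Real.pi / 2) * ℓ * M₁ * (X₁ - D) :=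
      mul_nonneg (by positivity) (sub_nonneg.2 hDX)
    linarith [h]
  have t2 : 2 * C * M₁ * ℓ * (Real.pi / 8 * N * V₀) ≤ 3 * Real.pi / 4 * C * V₀ * (ℓ * (X₁ * M₁)) := by
    have h : 0 ≤ Real.pi / 4 * C * V₀ * ℓ * M₁ * (3 * X₁ - N) :=
      mul_nonneg (by positivity) (sub_nonneg.2 hN)
    linarith [h]
  have t3 : 2 * Real.pi ^ 2 * D * C * M₁ ≤ Real.pi ^ 2 * C * (ℓ * (X₁ * M₁)) := by
    have h : 0 ≤ Real.pi ^ 2 * C * M₁ * ((ℓ - 2) * X₁ + 2 * (X₁ - D)) :=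
      mul_nonneg (by positivity) (add_nonneg (mul_nonneg (sub_nonneg.2 hℓ) hX)
        (mul_nonneg zero_le_two (sub_nonneg.2 hDX)))
    linarith [h]
  have t4 : Real.pi / 4 * C * ℓ * N * D * K₂ * (M₂ / c₀)
      ≤ 3 * Real.pi / (4 * c₀) * C * K₂ * (ℓ * (X₁ * D * M₂)) := by
    have h : 0 ≤ Real.pi / (4 * c₀) * C * K₂ * ℓ * D * M₂ * (3 * X₁ - N) :=
      mul_nonneg (by positivity) (sub_nonneg.2 hN)
    have e : 3 * Real.pi / (4 * c₀) * C * K₂ * (ℓ * (X₁ * D * M₂)) - Real.pi / 4 * C * ℓ * N * D * K₂ * (M₂ / c₀)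
        = Real.pi / (4 * c₀) * C * K₂ * ℓ * D * M₂ * (3 * X₁ - N) := by
      field_simp
    linarith [e]
  have t6 : 4 * R₀ * D * K₂ * (M₄ / c₀) = 4 * R₀ * K₂ / c₀ * (D * M₄) := by
    field_simp
  have hA1 : 0 ≤ ℓ * (X₁ * M₁) := by positivity
  have hA2 : 0 ≤ ℓ * (X₁ * D * M₂) := by positivity
  have hA3 : 0 ≤ D * M₄ := by positivity
  have hK1 : 0 ≤ 2 * C * (1 + 1 / (2 * Δ) + Real.pi / 2) := by positivity
  have hK2 : 0 ≤ 3 * Real.pi / 4 * C * V₀ := by positivity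
  have hK3 : 0 ≤ Real.pi ^ 2 * C := by positivity
  have hK4 : 0 ≤ 3 * Real.pi / (4 * c₀) * C * K₂ := by positivity
  have hK5 : 0 ≤ 4 * R₀ * V₀ := by positivity
  have hK6 : 0 ≤ 4 * R₀ * K₂ / c₀ := by positivity
  linarith [mul_nonneg hK1 hA2, mul_nonneg hK1 hM₃, mul_nonneg hK1 hA3, mul_nonneg hK2 hA2, mul_nonneg hK2 hM₃,
    mul_nonneg hK2 hA3, mul_nonneg hK3 hA2, mul_nonneg hK3 hM₃, mul_nonneg hK3 hA3, mul_nonneg hK4 hA1,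
    mul_nonneg hK4 hM₃, mul_nonneg hK4 hA3, mul_nonneg hK5 hA1, mul_nonneg hK5 hA2, mul_nonneg hK5 hA3,
    mul_nonneg hK6 hA1, mul_nonneg hK6 hA2, mul_nonneg hK6 hM₃]

/-! ### The uniform block bound -/

set_option maxHeartbeats 800000 in
/-- **Uniform block bound.**  For `g` irreducible of degree `d ≥ 2`, `Δ > 0`, `θ ≤ 1` and a local `ℓ¹`-mean bound
with constant `C` and exponent `η` for the Hooley sums, there are `K, x₁` such that for `X₁ = X₀ + D ≥ x₁`, `D ≤ X₀`
and every dyadic block `X₁ ≤ E ≤ E' ≤ 2E`: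
`‖Z(E,E']‖ ≤ K·[(2 + log E)(X₁E^{1−η} + X₁DE^{1−η−2/d}) + E^{2−θ} + DE^{2−θ−2/d}]`. [this work] -/
theorem exists_trapBlock_uniform {g : ℤ[X]} (hirr : Irreducible g) (hdeg : 2 ≤ g.natDegree) {Δ : ℝ}
    (hΔ : 0 < Δ) {C θ η : ℝ} (hC0 : 0 ≤ C) (hθ1 : θ ≤ 1)
    (hC : ∀ E₁ E₁' H₁ : ℕ, 1 ≤ E₁ → E₁ ≤ E₁' → E₁' ≤ 2 * E₁ → (H₁ : ℝ) ≤ (E₁ : ℝ) ^ θ →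
      ∑ h ∈ Icc 1 H₁, (‖∑ e ∈ Ioc E₁ E₁', hooleySum g e h‖ + ‖∑ e ∈ Ioc E₁ E₁', hooleySum g e (-(h : ℤ))‖)
        ≤ C * H₁ * (E₁ : ℝ) ^ (1 - η)) :
    ∃ K : ℝ, ∃ x₁ : ℕ, 0 ≤ K ∧ ∀ X₀ D E E' : ℕ, x₁ ≤ X₀ + D → D ≤ X₀ → X₀ + D ≤ E → E ≤ E' →
      E' ≤ 2 * E →
      ‖∑ e ∈ Ioc E E', 1 / (e : ℂ) * ∑ h ∈ Ico 1 e, trapKernel g Δ X₀ D e h * hooleySum g e h‖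
        ≤ K * ((2 + Real.log E) * ((X₀ + D : ℕ) * (E : ℝ) ^ (1 - η)
              + (X₀ + D : ℕ) * D * (E : ℝ) ^ (1 - η - 2 / g.natDegree))
            + (E : ℝ) ^ (2 - θ) + D * (E : ℝ) ^ (2 - θ - 2 / g.natDegree)) := by
  obtain ⟨m₀, hm₀⟩ := exists_natAbs_eval_lt_succ (g := g) (by omega)
  obtain ⟨C₁, hC₁⟩ := exists_abs_log_natAbs_succ_sub_le hirr hdeg
  obtain ⟨C₂, hC₂⟩ := exists_abs_log_natAbs_second_diff_le hirr hdeg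
  obtain ⟨c, hc, hcvan⟩ := exists_locWeight_eq_zero_of_pow_le hirr hdeg hΔ
  obtain ⟨e₀, he₀⟩ := exists_locWeight_zero_eq_zero hirr hdeg hΔ
  obtain ⟨R₀, hR₀0, hR₀⟩ := exists_sum_Ioc_rootCount_div_le hirr (by omega)
  have hz : ∀ k : ℕ, g.eval (k : ℤ) ≠ 0 := eval_natCast_ne_zero_of_irreducible hirr hdeg
  have hmono : ∀ m m' : ℕ, m₀ ≤ m → m ≤ m' → (g.eval (m : ℤ)).natAbs ≤ (g.eval (m' : ℤ)).natAbs :=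
    fun m m' hm hmm' => natAbs_eval_mono hm₀ hm hmm'
  have hC₁0 : 0 ≤ C₁ := by
    have h := hC₁ 1 le_rfl
    norm_num at h
    exact (abs_nonneg _).trans h
  have hC₂0 : 0 ≤ C₂ := by
    have h := hC₂ 1 le_rfl
    norm_num at h
    exact (abs_nonneg _).trans h
  set d : ℕ := g.natDegree with hd
  have hd0 : d ≠ 0 := by omega
  set c₀ : ℝ := c ^ ((d : ℝ)⁻¹) with hc₀
  have hc₀0 : 0 < c₀ := Real.rpow_pos_of_pos hc _
  set V₀ : ℝ := 2 + C₁ / (2 * Δ) with hV₀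
  set K₂ : ℝ := (C₂ + 4 * C₁) / Δ with hK₂
  have hV₀0 : 0 ≤ V₀ := by positivity
  have hK₂0 : 0 ≤ K₂ := by positivity
  set M : ℕ := max 4 (m₀ + 2) with hM
  set xA : ℕ := ⌈(M : ℝ) ^ d / c⌉₊ + 1 with hxA
  refine ⟨2 * C * (1 + 1 / (2 * Δ) + Real.pi / 2) + 3 * Real.pi / 4 * C * V₀ + Real.pi ^ 2 * C
      + 3 * Real.pi / (4 * c₀) * C * K₂ + 4 * R₀ * V₀ + 4 * R₀ * K₂ / c₀, max e₀ (max 2 xA),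
    by positivity, ?_⟩
  intro X₀ D E E' hx₁ hDX hXE hEE' hE'2
  have he₀X : e₀ ≤ X₀ + D := le_trans (le_max_left _ _) hx₁
  have h2X : 2 ≤ X₀ + D := le_trans ((le_max_left _ _).trans (le_max_right _ _)) hx₁
  have hxAX : xA ≤ X₀ + D := le_trans ((le_max_right _ _).trans (le_max_right _ _)) hx₁
  have hE2 : 2 ≤ E := h2X.trans hXE
  have hE1 : 1 ≤ E := by omega
  have hE0 : (0 : ℝ) < E := by exact_mod_cast (show 0 < E by omega)
  have hE1r : (1 : ℝ) ≤ E := by exact_mod_cast hE1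
  -- the vanishing range
  set y : ℝ := (c * (E : ℝ) ^ 2) ^ ((d : ℝ)⁻¹) with hy
  have hMy : (M : ℝ) ≤ y := by
    have h1 : (M : ℝ) ^ d / c ≤ xA := by
      calc (M : ℝ) ^ d / c ≤ ⌈(M : ℝ) ^ d / c⌉₊ := Nat.le_ceil _
        _ ≤ xA := by rw [hxA]; push_cast; linarith
    have hxE : (xA : ℝ) ≤ E := by exact_mod_cast hxAX.trans hXE
    have h2 : (M : ℝ) ^ d ≤ c * (E : ℝ) ^ 2 := by
      rw [div_le_iff₀ hc] at h1
      calc (M : ℝ) ^ d ≤ xA * c := h1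
        _ ≤ E * c := by gcongr
        _ ≤ (E : ℝ) ^ 2 * c := by gcongr; nlinarith
        _ = c * (E : ℝ) ^ 2 := mul_comm _ _
    calc (M : ℝ) = ((M : ℝ) ^ d) ^ ((d : ℝ)⁻¹) := (Real.pow_rpow_inv_natCast (Nat.cast_nonneg _) hd0).symm
      _ ≤ y := Real.rpow_le_rpow (by positivity) h2 (by positivity)
  have hy4 : 4 ≤ y := le_trans (by exact_mod_cast le_max_left 4 (m₀ + 2)) hMy
  have hym : (m₀ : ℝ) + 2 ≤ y := le_trans (by exact_mod_cast le_max_right 4 (m₀ + 2)) hMy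
  have hy0 : 0 < y := by linarith
  obtain ⟨hAm, hA1, hApow, hAy⟩ := trapRange_choice hy4 hym d
  set A : ℕ := ⌊y⌋₊ - 1 with hA
  have hyd : y ^ d = c * (E : ℝ) ^ 2 := by rw [hy]; exact Real.rpow_inv_natCast_pow (by positivity) hd0
  have hvan : ∀ e : ℕ, E ≤ e → ∀ m : ℕ, m ≤ A + 1 → locWeight g Δ e m = 0 := by
    intro e he m hm
    rcases Nat.eq_zero_or_pos m with rfl | hm1
    · exact he₀ e (he₀X.trans (hXE.trans he))
    · apply hcvan e m hm1
      have hmA : (m : ℝ) ≤ (A : ℝ) + 1 := by exact_mod_cast hm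
      have her : (E : ℝ) ≤ e := by exact_mod_cast he
      calc (m : ℝ) ^ d ≤ ((A : ℝ) + 1) ^ d := pow_le_pow_left₀ (Nat.cast_nonneg _) hmA d
        _ ≤ y ^ d := hApow
        _ = c * (E : ℝ) ^ 2 := hyd
        _ ≤ c * (e : ℝ) ^ 2 := by gcongr
  -- the frequency cut
  obtain ⟨hH, hHθ, hH4, hHE⟩ := trapFreq_choice hE2 hθ1
  set H : ℕ := ⌊(E : ℝ) ^ θ⌋₊ / 4 with hHdef
  have hblock := norm_trapBlock_le g hΔ X₀ D hz hAm hA1 hmono hC₁ hC₂ hE1 hEE' hE'2 hH hvan hC0 hHθ hC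
  refine hblock.trans ?_
  clear hblock hC hcvan hvan hC₁ hC₂ hmono hm₀ he₀ hz
  -- abbreviations
  set ℓ : ℝ := 2 + Real.log E with hℓ
  set M₁ : ℝ := (E : ℝ) ^ (1 - η) with hM₁
  set M₂ : ℝ := (E : ℝ) ^ (1 - η - 2 / d) with hM₂
  set M₃ : ℝ := (E : ℝ) ^ (2 - θ) with hM₃
  set M₄ : ℝ := (E : ℝ) ^ (2 - θ - 2 / d) with hM₄
  set N : ℝ := ((X₀ + D + 2 : ℕ) : ℝ) with hN
  set N' : ℝ := ((X₀ + D + 3 : ℕ) : ℝ) with hN'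
  set V : ℝ := 2 + D * C₁ / (2 * Δ * ((X₀ : ℝ) + 1)) + D * ((C₂ + 4 * C₁) / (2 * Δ * A)) with hV
  set Vb : ℝ := V₀ + D * K₂ / y with hVb
  set R : ℝ := ∑ e ∈ Ioc E E', (polyRootCountMod ![g] e : ℝ) / e with hR
  have hX₁E : ((X₀ + D : ℕ) : ℝ) ≤ E := by exact_mod_cast hXE
  have hDXr : (D : ℝ) ≤ ((X₀ + D : ℕ) : ℝ) := by push_cast; linarith [(Nat.cast_nonneg X₀ : (0 : ℝ) ≤ X₀)]
  have hN3 : N ≤ 3 * ((X₀ + D : ℕ) : ℝ) := by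
    rw [hN]; push_cast
    have : (2 : ℝ) ≤ ((X₀ + D : ℕ) : ℝ) := by exact_mod_cast h2X
    push_cast at this; linarith
  have hℓ2 : 2 ≤ ℓ := by have := Real.log_natCast_nonneg E; rw [hℓ]; linarith
  have hM₁0 : 0 ≤ M₁ := by positivity
  have hM₃0 : 0 ≤ M₃ := by positivity
  have hVb0 : 0 ≤ Vb := by positivity
  -- `y = c₀ E^{2/d}` and the two exponent identities
  have hyeq : y = c₀ * (E : ℝ) ^ ((2 : ℝ) / d) := by
    rw [hy, hc₀, Real.mul_rpow hc.le (by positivity), div_eq_mul_inv,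
      show ((E : ℝ) ^ 2) = (E : ℝ) ^ ((2 : ℕ) : ℝ) from (Real.rpow_natCast _ 2).symm,
      ← Real.rpow_mul hE0.le]
    norm_num
  have hy1 : M₁ / y = M₂ / c₀ := by
    have hsplit : M₁ = M₂ * (E : ℝ) ^ ((2 : ℝ) / d) := by
      rw [hM₁, hM₂, ← Real.rpow_add hE0, sub_add_cancel]
    rw [div_eq_div_iff hy0.ne' hc₀0.ne', hsplit, hyeq]; ring
  have hy3 : M₃ / y = M₄ / c₀ := by
    have hsplit : M₃ = M₄ * (E : ℝ) ^ ((2 : ℝ) / d) := by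
      rw [hM₃, hM₄, ← Real.rpow_add hE0, sub_add_cancel]
    rw [div_eq_div_iff hy0.ne' hc₀0.ne', hsplit, hyeq]; ring
  -- `V ≤ Vb`
  have hVVb : V ≤ Vb := by
    have h1 : D * C₁ / (2 * Δ * ((X₀ : ℝ) + 1)) ≤ C₁ / (2 * Δ) := by
      rw [div_le_div_iff₀ (by positivity) (by positivity)]
      have : (D : ℝ) ≤ X₀ := by exact_mod_cast hDX
      have : 0 ≤ C₁ * (2 * Δ) * ((X₀ : ℝ) + 1 - D) := by
        exact mul_nonneg (by positivity) (by linarith)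
      linarith
    have h2 : (D : ℝ) * ((C₂ + 4 * C₁) / (2 * Δ * A)) ≤ D * K₂ / y := by
      have hA0 : (0 : ℝ) < A := by exact_mod_cast (show 0 < A by omega)
      rw [mul_div_assoc]
      apply mul_le_mul_of_nonneg_left _ (Nat.cast_nonneg D)
      rw [hK₂, div_div]
      have hyA : Δ * y ≤ 2 * Δ * A := by
        have := mul_le_mul_of_nonneg_left hAy hΔ.le; linarith
      exact div_le_div_of_nonneg_left (by positivity) (by positivity) hyA
    rw [hV, hVb, hV₀]; linarith [h1, h2]
  -- the three substitutions
  have s1 : ((D : ℝ) / 2 + ((D : ℝ) / (2 * Δ) + Real.pi / 8 * (N * V + 4 * D) + D / 2))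
        * (C * M₁ * (2 + Real.log H))
      ≤ ((D : ℝ) / 2 + ((D : ℝ) / (2 * Δ) + Real.pi / 8 * (N * Vb + 4 * D) + D / 2)) * (C * M₁ * ℓ) := by
    have hlog : 2 + Real.log H ≤ ℓ := by
      rw [hℓ]; linarith [log_natCast_le_of_le hHE]
    have hlog0 : 0 ≤ 2 + Real.log (H : ℝ) := by linarith [Real.log_natCast_nonneg H]
    apply mul_le_mul _ (mul_le_mul_of_nonneg_left hlog (by positivity)) (by positivity) (by positivity)
    gcongr
  have s2 : Real.pi ^ 2 * D * N' / 4 * (C * H * M₁) / (E : ℝ) ^ 2 ≤ Real.pi ^ 2 * D * C * M₁ := by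
    have hN'E : N' ≤ 4 * E := by
      rw [hN']; push_cast; push_cast at hX₁E; linarith
    have hHE' : (H : ℝ) ≤ E := by exact_mod_cast hHE
    rw [div_le_iff₀ (by positivity)]
    have key : 0 ≤ Real.pi ^ 2 * D * C * M₁ * ((4 * E - N') * E + N' * (E - H)) :=
      mul_nonneg (by positivity) (add_nonneg (mul_nonneg (by linarith) hE0.le)
        (mul_nonneg (by positivity) (by linarith)))
    linarith [key]
  have s3 : V * (E' : ℝ) ^ 2 * R / (4 * ((H : ℝ) + 1)) ≤ Vb * (4 * R₀ * M₃) := by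
    have hR0 : 0 ≤ R := sum_nonneg fun e _ => by positivity
    have hRR₀ : R ≤ R₀ := hR₀ E E' hE1 hEE' hE'2
    have hE'r : (E' : ℝ) ≤ 2 * E := by exact_mod_cast hE'2
    have hθpos : 0 < (E : ℝ) ^ θ := Real.rpow_pos_of_pos hE0 θ
    have hM₃eq : M₃ * (E : ℝ) ^ θ = (E : ℝ) ^ 2 := by
      rw [hM₃, ← Real.rpow_add hE0, sub_add_cancel, Real.rpow_two]
    have hV0 : 0 ≤ V := by positivity
    calc V * (E' : ℝ) ^ 2 * R / (4 * ((H : ℝ) + 1))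
        ≤ Vb * (2 * E) ^ 2 * R₀ / (4 * ((H : ℝ) + 1)) := by
          apply div_le_div_of_nonneg_right _ (by positivity)
          gcongr
      _ ≤ Vb * (2 * E) ^ 2 * R₀ / (E : ℝ) ^ θ :=
          div_le_div_of_nonneg_left (by positivity) hθpos hH4
      _ = Vb * (4 * R₀ * M₃) := by
          rw [div_eq_iff hθpos.ne', show Vb * (4 * R₀ * M₃) * (E : ℝ) ^ θ = Vb * 4 * R₀ * (M₃ * (E : ℝ) ^ θ) by ring,
            hM₃eq]
          ring
  have halg := uniform_algebra (N := N) hC0 hΔ (Nat.cast_nonneg D) hDXr hN3 hℓ2 hM₁0 (by positivity : 0 ≤ M₂) hM₃0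
    (by positivity : 0 ≤ M₄) hV₀0 hK₂0 hR₀0 hc₀0 hy1 hy3
  rw [← hVb] at halg
  linarith [s1, s2, s3, halg]

end Summit.Parity.BatemanHorn.Theorems
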